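import Literature.MathematicalPhysics.QuantumFieldTheory.Balaban1983to89.B11TildeG190
import Literature.MathematicalPhysics.QuantumFieldTheory.Balaban1983to89.B11SupSize190

/-!
# Bałaban, *The variational problem and background fields in renormalization group method for lattice gauge
# theories*, Commun. Math. Phys. **102** (1985) 277–309 — the (190) letter of `(δ/δB)𝓗(0) = H₀ + G̃Δ⁽²⁾H₀`
# FROM THE BASE LETTERS of Sects. E–G: (3.133) for `H₀`, [5] Thm 3.3 (3.42) for `G₀ = Δ_a⁻¹`, (3.137) for `Δ⁽²⁾`,
# (3.132) for `(QG′Q*)⁻¹`, the locality of `Q`, `Q*` — with the majorants of the NEW `G′ = (Δ_a − Δ⁽²⁾)⁻¹` (p. 306)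
# and of `G̃ = G′P₀′*` ((131)/(143)) DERIVED, and `G′` CONSTRUCTED on finite carriers

CITATION HEADER (lean-in-tree rule 2026-08-18).  Source: T. Bałaban, Commun. Math. Phys. **102** (1985) 277–309,
doi:10.1007/BF01229381 [Balaban1985Variational] (cell paper B11 = [15] of [Balaban1987RG1]; held
`paper:balaban1985-cmp102-variational-background`, journal page = PDF page + 276); its ref. [5] = T. Bałaban, *Propagators
for lattice gauge theories in a background field*, Commun. Math. Phys. **99** (1985) 389–434 [Balaban1985BackgroundPropagators]
(B9); its ref. [3] = *Propagators and renormalization transformations for lattice gauge theories. II*, Commun. Math. Phys.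
**96** (1984) 223–250 [Balaban1984PropagatorsII] (B6).  Passages used (all read in the siblings' quotations, locators
theirs): p. 297 after (128) *"Δ_a = Δ + DRD* + Q*aQ (the constant a = 1). For the operator Δ_a⁻¹ = G we have proved Theorem
3.3 in [5], and especially the bounds (3.42)"*; (129) *"H₀B = GQ*(QGQ*)⁻¹(L^{j(·)}η)⁻¹B … satisfies the bound (3.133) [5]"*;
(131) p. 298 *"P₀ = I − GQ*(QGQ*)⁻¹Q"*; p. 300 *"GP₀* = G − GQ*(QGQ*)⁻¹[QG] = G̃"* (cell GAPS G-adv7-5); p. 306 after (179)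
*"defining G = (Δ_a − Δ⁽²⁾)⁻¹. From the estimate (3.137) it follows that Δ⁽²⁾ is a small perturbation of Δ_a, and the new
operator G has exactly the same properties as Δ_a⁻¹"* (cell GAPS G-B11-G1); (180); (182) p. 307; (190) p. 308; [5] (3.42)
p. 397, (3.132)–(3.133) p. 422, (3.137)–(3.138) p. 423; [3] (2.51)–(2.56) pp. 232–233, Lemma 2.1 (2.61) p. 234.

WHY THIS FILE (audit cell `pub-balaban`, BINDER row (D4), OWNER lineage `b2b-balaban-beta-an4`, gen 105).  The row's NODE D
— the (190) letter consumed by `Beta.RemainderDecay190*.Data190.h190` — is, for the ACTUAL derivative of the (179)-chart AT THE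
ORIGIN, the block majorant of ONE operator, `(δ/δB)𝓗(0) = H₀ + G̃Δ⁽²⁾H₀` in EVERY background
(`Beta.RemainderChartOriginDerivative.fderiv_chartH179_zero`; at `B = 0` the operator `G̃((δ²/δA′²)V)` inverted in (188) vanishes
because `V` (80) is of order ≥ 3).  `Beta.RemainderChartOriginDerivative.ineq190_fderiv_chartH179_zero_of_letters` reads that
majorant off THREE letters `hH0`, `hG` (of `G̃`), `hD2H0` (of `Δ⁽²⁾H₀`).  THIS FILE reduces the three to the BASE LETTERS of
[5] in the background field — the currency in which the tree's B9 programme (`B9Eq342*`, `B9Ineq3133Assembly`, `B9Ineq3137*`,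
`B9Thm37GlueTorus*`) produces its theorems — by kernel-checked bookkeeping only:
* §1 `hD2H0` ⇐ `hH0` + the LOCALITY of `Δ⁽²⁾` ((3.137): finite range, small row sums), NO rate lost
  (`B11Reparam190.hasMaj_comp_localLeft`); or + an exponential letter of `Δ⁽²⁾`, one row sum (`B11SectG.hasMaj_comp_exp`).
* §1b `hH0` itself ⇐ `hG0` + the locality of `Q*` and of the source scaling `J : B ↦ (L^{j}η)⁻¹B` + a (3.132)-shape letter for
  `(QG₀Q*)⁻¹` (`hasMaj_H0_of_base_letters`; [5] p. 422 *"(3.132) together with Theorem 3.3 for G … give (3.133)"*, one entry, one row sum).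
* §2 the NEW `G′ = (Δ_a − Δ⁽²⁾)⁻¹` between TWO block-normed spaces (`Δ_a : FA → F3` per (115)) inherits the first entry of Thm
  3.3 for `G₀ = Δ_a⁻¹` — the template (3.138) of [5] with `Δ′_π` absent (`B11SectG.neumann_majorant`): from `hG0`, the local
  (or exponential) letter of `Δ⁽²⁾`, the resolvent identity `G′ = G₀ + G₀Δ⁽²⁾G′` (`newG_fix_of_inverse`), an a priori bound and
  ONE smallness `q < 1`; constant `B(1 − q)⁻¹`, one (or two) row sums.  (The one-space, sharp-block version of this step is
  `B6RandomWalkHom.b11_newG_leftEntry_of_3137`; the one-space `HasMaj` version with an exponential perturbation is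
  `B9SectDL2Decay.rightEntry_majorant`.)
* §3 `G̃ = G′ − G′Q*·(QG′Q*)⁻¹·QG′` inherits the first entry of `G′` — `B11TildeG190.hasMaj_leftEntry_tildeG` at `E = 1` —
  from the locality of `Q`, `Q*` and a (3.132)-shape letter `hInv`.
* §4 THE ASSEMBLY `hasMaj_origin_of_base_letters` ∕ **`ineq190_origin_of_base_letters`**: `Ineq190 bB bN (H₀ + G̃Δ⁽²⁾H₀)
  (A₀ + κ₃B_G̃θ_Dc) δ` for `δ/8 ≤ ρ ≤ δ₀`, `ρ + 3σ ≤ min(δ₁, δ_I)`, every constant in closed form.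
* §5 FINITE CARRIERS `X → E` with the sup sizes of (190) (`B11SupSize190.supSize`, boxes = fibres of the block map — the
  currency of `Beta.RemainderHasMajGreenPrime` and of the row's two-grid sockets): the a priori bound is AUTOMATIC
  (`hasMaj_supSize_const_of_opNorm`), a decaying majorant bounds the operator norm (`opNorm_le_of_hasMaj_supSize`), and
  **`exists_newG_supSize`**: under `q = Bλe^{δ₁r}c < 1` the operator `1 − G₀Δ⁽²⁾` is a unit of the Banach algebra of operators
  (`‖G₀Δ⁽²⁾‖ ≤ q`; Mathlib `isUnit_one_sub_of_norm_lt_one`), `G′ := (1 − G₀Δ⁽²⁾)⁻¹G₀` is a two-sided inverse of `Δ_a − Δ⁽²⁾`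
  solving the resolvent identity, with the majorant `B(1 − q)⁻¹e^{−ρd}` — p. 306's sentence, first entry, CONSTRUCTED.
* §6 **`ineq190_origin_supSize`**: the END on finite carriers — the (190) letter of `H₀ + G̃Δ⁽²⁾H₀` from `hH0`, `hG0`, the
  three local letters, `hInv` and the invertibility relations alone.

THE LETTER LIST OF NODE D AT THE ORIGIN IN A BACKGROUND, as this file leaves it (each a hypothesis of the printed SHAPE; which
are in the tree as theorems is the row's audit, not asserted here): (L1) `hH0` — (3.133) for `H₀ = G₀Q*(QG₀Q*)⁻¹(L^jη)⁻¹`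
(`B9Ineq3133Assembly` assembles it from Thm-3.3-shape entries of `G₀` and a (3.132)-shape letter of `(QG₀Q*)⁻¹`; §1b reduces it, in
this currency, to (L2) + a (3.132)-shape letter `hInv₀` for `(QG₀Q*)⁻¹` + the locality of `Q*` and of the source scaling); (L2) `hG0` —
[5] Thm 3.3 (3.42), first entry, for the BOND operator `Δ_a⁻¹ = (Δ + DRD* + Q*Q)⁻¹` in the background (tree: `B9.Thm33Printed`,
statement; the NE9 programme's `B9Eq342*` prove the SITE operator `G′(U)` of Thm 3.1); (L3) `hInv` — (3.132) for `(QG′Q*)⁻¹`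
with the NEW `G′` (cell GAPS G-B11-G1 residual (r1), G-IF-02R); (L4) the locality of `Δ⁽²⁾` ((3.134)–(3.137); concrete:
`B9Eq3134MatrixConcrete`, `B9Ineq3137*`), of `Q`, `Q*` (the averaging operators); (L5) `G₀Δ_a = 1`, `(Δ_a − Δ⁽²⁾)G′ = 1`
(existence: §5 under `q < 1`); (L6) ONE smallness `q = κ_Nκ₃Bλe^{δ₁r_D}c < 1` — *"Δ⁽²⁾ is a small perturbation"*, a condition
on `Mα₀` ∕ `ε₁` through (3.137) and (28) (cell SMALLNESS S-B11.8); (L7) (2.54) and Lemma 2.1 (2.61) of [3] for the geometry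
(the row's torus geometry: `Beta.RemainderRowSum`).  NOT on the list (C-an4g103-R1): (189), (187)–(188), `H` (46), `𝔇` (73).

HONEST SCOPE.  Bookkeeping over `B11SectG`'s block majorants ([folklore] compositions of the siblings' kernel-checked lemmas)
plus one Neumann-series construction in a Banach algebra; NO estimate of [5] or [15] is proved; nothing identifies Bałaban's
step-`k` operators `Δ_a`, `Δ⁽²⁾`, `Q`, `H₀` with tree terms (NODE O); the rate bookkeeping `ρ + 3σ` and the constants are this
file's, absorbed in print's *"O(1)"*, *"δ₀"* (cell DIVERGENCE D-B11-25).  Row (D4) class UNCHANGED (instance 0∕1; D4 DISCHARGE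
NO DATE); NOT B12 Thm 2, NOT BetaPertH, NOT continuum, NOT Clay.  HONEST DEPENDENCY (cell line): continuum YM on T⁴ ⇐ BetaPertH
∧ nine spine estimates (0/9 proved); BetaPertH ⇐ (D1) ∧ (D4) ∧ CAP+tail; G-an2-4 gates asym, D1 and NE2/3/4.  NEW file importing
`B11TildeG190` + `B11SupSize190` only (both built); nothing modified; 0 `def`; standard axioms; no `sorry`.
-/

namespace Literature.MathematicalPhysics.QuantumFieldTheory.Balaban1983to89.Beta.RemainderOriginBaseLetters

open Literature.MathematicalPhysics.QuantumFieldTheory.Balaban1983to89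
open Finset B6RandomWalk B11SectG B11Reparam190 B11TildeG190 B11SupSize190

variable {g : B6.Geometry}

/-! ## §1  `hD2H0` ⇐ `hH0` + the (3.137) letter of `Δ⁽²⁾` -/

section D2H0

variable {FB FA F3 : Type} [AddCommGroup FB] [Module ℝ FB] [AddCommGroup FA] [Module ℝ FA]
  [AddCommGroup F3] [Module ℝ F3]

/-- **`Δ⁽²⁾H₀` FROM `H₀` AND A LOCAL `Δ⁽²⁾`, NO RATE LOST.**  If `H₀ : FB → FA` has the majorant `A₀e^{−δ₀d}` between
the block sizes `bB → bN` ((129) with *"the bound (3.133) [5]"*) and `Δ⁽²⁾ : FA → F3` is LOCAL — a majorant `K_D ≥ 0`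
from `bN` into `b3` vanishing unless `d(y,y′) ≤ r`, with row sums `≤ λ` ([5] (3.137): a second-order difference operator
with the small coefficients of (3.134)–(3.135)) — then `Δ⁽²⁾H₀` has the majorant `κ_N·A₀·λ·e^{δ₀r}·e^{−δ₀d}` from `bB`
into `b3`: the `hD2H0` letter of `B11SectG.ineq190_of_189` ∕ `Beta.RemainderChartOriginDerivative.…_of_letters` at the
SAME rate `δ₀`. [cite: Balaban1985Variational, (129)–(130) p.297, (180) p.306; Balaban1985BackgroundPropagators, (3.133) p.422, (3.137) p.423; Balaban1984PropagatorsII, (2.52)–(2.55) p.232] -/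
theorem hasMaj_D2H0_of_local {bB : BlockNorm g FB} {bN : BlockNorm g FA} {b3 : BlockNorm g F3}
    {H0 : FB →ₗ[ℝ] FA} {D2 : FA →ₗ[ℝ] F3} {KD : g.Site → g.Site → ℝ} {A₀ δ₀ r lam : ℝ}
    (htri : Triangle254 g) (hA₀ : 0 ≤ A₀) (hδ₀ : 0 ≤ δ₀)
    (hKD : ∀ a b, 0 ≤ KD a b) (hDloc : ∀ a b, KD a b ≠ 0 → g.dist a b ≤ r)
    (hDrow : ∀ a, ∑ b : g.Site, KD a b ≤ lam) (hD2 : HasMaj bN b3 D2 KD)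
    (hH0 : HasMaj bB bN H0 (fun a b => A₀ * Real.exp (-(δ₀ * g.dist a b)))) :
    HasMaj bB b3 (D2 ∘ₗ H0)
      (fun a b => bN.κ * A₀ * lam * Real.exp (δ₀ * r) * Real.exp (-(δ₀ * g.dist a b))) :=
  hasMaj_comp_localLeft htri hA₀ hδ₀ hKD hDloc hDrow hD2 hH0

/-- **`Δ⁽²⁾H₀` FROM `H₀` AND AN EXPONENTIAL LETTER OF `Δ⁽²⁾`, ONE ROW SUM.**  With `Δ⁽²⁾` of majorant `θe^{−δ₂d}`
(`bN → b3`) and `H₀` of majorant `A₀e^{−δ₀d}` (`bB → bN`): `Δ⁽²⁾H₀` has the majorant `κ_N·θ·A₀·c·e^{−ρd}` for every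
`ρ ≥ 0` with `ρ ≤ δ₀`, `ρ + σ ≤ δ₂` (the triangle inequality (2.54) and the row sum (2.61) of Lemma 2.1 [3] at the rate `σ`);
for a local `Δ⁽²⁾` take `δ₂ = δ₀ + σ` and lose nothing. [cite: Balaban1985Variational, (129)–(130) p.297, (180) p.306; Balaban1985BackgroundPropagators, (3.137) p.423; Balaban1984PropagatorsII, (2.54) p.233, Lemma 2.1 (2.61) p.234] -/
theorem hasMaj_D2H0_of_exp {bB : BlockNorm g FB} {bN : BlockNorm g FA} {b3 : BlockNorm g F3}
    {H0 : FB →ₗ[ℝ] FA} {D2 : FA →ₗ[ℝ] F3} {A₀ θ δ₀ δ₂ ρ σ c : ℝ}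
    (htri : Triangle254 g) (hd : ∀ a b : g.Site, 0 ≤ g.dist a b) (hrow : RowSum g σ c)
    (hA₀ : 0 ≤ A₀) (hθ : 0 ≤ θ) (hρ : 0 ≤ ρ) (hρ₀ : ρ ≤ δ₀) (hρ₂ : ρ + σ ≤ δ₂)
    (hD2 : HasMaj bN b3 D2 (fun a b => θ * Real.exp (-(δ₂ * g.dist a b))))
    (hH0 : HasMaj bB bN H0 (fun a b => A₀ * Real.exp (-(δ₀ * g.dist a b)))) :
    HasMaj bB b3 (D2 ∘ₗ H0) (fun a b => bN.κ * θ * A₀ * c * Real.exp (-(ρ * g.dist a b))) :=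
  hasMaj_comp_exp htri hd hrow hθ hA₀ hρ hρ₀ hρ₂ hD2 hH0

end D2H0

/-! ## §1b  `hH0` itself ⇐ `hG0` + the locality of `Q*` and of the source scaling + a (3.132)-shape letter for `(QG₀Q*)⁻¹` -/

section H0

variable {FB FA F3 FQ : Type} [AddCommGroup FB] [Module ℝ FB] [AddCommGroup FA] [Module ℝ FA]
  [AddCommGroup F3] [Module ℝ F3] [AddCommGroup FQ] [Module ℝ FQ]

/-- **`H₀ = G₀Q*(QG₀Q*)⁻¹(L^{j}η)⁻¹` ((129)) INHERITS THE FIRST ENTRY OF `G₀`** — [5] p. 422: *"The above inequality [(3.132)]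
together with Theorem 3.3 for G … give (3.133)"* (the tree's `B9Ineq3133Assembly` is the sup-and-Hölder version over localized
seminorms; this is the one-entry version in the row's currency).  With `G₀ : F3 → FA` of majorant `Be^{−δ₁d}` (`b3 → bN`), `Q* : FQ → F3`
LOCAL (range `r_Q`, column sums `ν_{Q*}`; `bQ′ → b3`), `Inv₀ = (QG₀Q*)⁻¹ : FQ → FQ` of majorant `B_Ie^{−δ_Id}` (`bQ → bQ′`; the shape of
(3.132)) and the source map `J : FB → FQ` (the scaling `B ↦ (L^{j(·)}η)⁻¹B` read into the `Q`-size) LOCAL (range `r_J`, column sums `ν_J`;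
`bB → bQ`): `H₀ = G₀Q*·Inv₀·J` has the majorant `κ_{Q′}·(κ₃Bν_{Q*}e^{δ₁r_Q})·(κ_QB_Iν_Je^{δ_Ir_J})·c·e^{−ρd}` from `bB` into `bN` for every
`ρ ≥ 0` with `ρ ≤ δ_I`, `ρ + σ ≤ δ₁` (the two local factors cost no rate; ONE row sum between `G₀Q*` and `Inv₀J`).
[cite: Balaban1985Variational, (129)–(130) p.297; Balaban1985BackgroundPropagators, (3.132)–(3.133) p.422, Thm 3.3 (3.42) p.397+p.399; Balaban1984PropagatorsII, (2.54) p.233, Lemma 2.1 (2.61) p.234] -/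
theorem hasMaj_H0_of_base_letters {bB : BlockNorm g FB} {bN : BlockNorm g FA} {b3 : BlockNorm g F3} {bQ bQ' : BlockNorm g FQ}
    {H0 : FB →ₗ[ℝ] FA} {G0 : F3 →ₗ[ℝ] FA} {Qs : FQ →ₗ[ℝ] F3} {Inv0 : FQ →ₗ[ℝ] FQ} {J : FB →ₗ[ℝ] FQ}
    {KQs KJ : g.Site → g.Site → ℝ} {B BI δ₁ δI ρ σ c rQ rJ νs νJ : ℝ}
    (htri : Triangle254 g) (hd : ∀ a b : g.Site, 0 ≤ g.dist a b) (hrow : RowSum g σ c)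
    (hB : 0 ≤ B) (hBI : 0 ≤ BI) (hνs : 0 ≤ νs) (hνJ : 0 ≤ νJ) (hρ : 0 ≤ ρ) (hσ : 0 ≤ σ) (hρI : ρ ≤ δI) (hρ₁ : ρ + σ ≤ δ₁)
    (hH0def : H0 = ((G0 ∘ₗ Qs) ∘ₗ Inv0) ∘ₗ J)
    (hG0 : HasMaj b3 bN G0 (fun a b => B * Real.exp (-(δ₁ * g.dist a b))))
    (hKQs : ∀ a b, 0 ≤ KQs a b) (hQsloc : ∀ a b, KQs a b ≠ 0 → g.dist a b ≤ rQ)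
    (hQscol : ∀ b, ∑ a : g.Site, KQs a b ≤ νs) (hQs : HasMaj bQ' b3 Qs KQs)
    (hInv0 : HasMaj bQ bQ' Inv0 (fun a b => BI * Real.exp (-(δI * g.dist a b))))
    (hKJ : ∀ a b, 0 ≤ KJ a b) (hJloc : ∀ a b, KJ a b ≠ 0 → g.dist a b ≤ rJ)
    (hJcol : ∀ b, ∑ a : g.Site, KJ a b ≤ νJ) (hJ : HasMaj bB bQ J KJ) :
    HasMaj bB bN H0 (fun a b =>
      bQ'.κ * (b3.κ * B * νs * Real.exp (δ₁ * rQ)) * (bQ.κ * BI * νJ * Real.exp (δI * rJ)) * c *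
        Real.exp (-(ρ * g.dist a b))) := by
  have hδ₁ : 0 ≤ δ₁ := by linarith
  have hδI : 0 ≤ δI := hρ.trans hρI
  -- G₀Q* : bQ′ → bN at the rate δ₁ (local factor on the right)
  have h1 : HasMaj bQ' bN (G0 ∘ₗ Qs)
      (fun a b => b3.κ * B * νs * Real.exp (δ₁ * rQ) * Real.exp (-(δ₁ * g.dist a b))) :=
    hasMaj_comp_localRight htri hB hδ₁ hKQs hQsloc hQscol hG0 hQs
  -- Inv₀J : bB → bQ′ at the rate δ_I (local factor on the right)
  have h2 : HasMaj bB bQ' (Inv0 ∘ₗ J)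
      (fun a b => bQ.κ * BI * νJ * Real.exp (δI * rJ) * Real.exp (-(δI * g.dist a b))) :=
    hasMaj_comp_localRight htri hBI hδI hKJ hJloc hJcol hInv0 hJ
  have ha₁ : 0 ≤ b3.κ * B * νs * Real.exp (δ₁ * rQ) :=
    mul_nonneg (mul_nonneg (mul_nonneg b3.κ_nonneg hB) hνs) (Real.exp_nonneg _)
  have ha₂ : 0 ≤ bQ.κ * BI * νJ * Real.exp (δI * rJ) :=
    mul_nonneg (mul_nonneg (mul_nonneg bQ.κ_nonneg hBI) hνJ) (Real.exp_nonneg _)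
  -- one row sum between the two
  refine (hasMaj_comp_exp htri hd hrow ha₁ ha₂ hρ hρI hρ₁ h1 h2).congr fun μ => ?_
  rw [hH0def]
  rfl

end H0

/-! ## §2  p. 306: the NEW `G′ = (Δ_a − Δ⁽²⁾)⁻¹` *"has exactly the same properties as Δ_a⁻¹"* — the first entry, between two block-normed spaces -/

section NewG

variable {FA F3 : Type} [AddCommGroup FA] [Module ℝ FA] [AddCommGroup F3] [Module ℝ F3]

/-- **THE NEW `G′ = (Δ_a − Δ⁽²⁾)⁻¹` INHERITS THE FIRST ENTRY OF [5] THM 3.3 FOR `G₀ = Δ_a⁻¹`, LOCAL `Δ⁽²⁾`, ONE ROW SUM.**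
Setting ((115): `Δ_a : FA → F3`, so `G₀, G′ : F3 → FA` and `Δ⁽²⁾ : FA → F3` — two block-normed spaces `b3` (the
`|·|_{(−3)}`-type size of the sources) and `bN` (the size of the fields)): `G₀` has the majorant `Be^{−δ₁d}` ((3.42), first
entry, for `Δ_a⁻¹` — p. 297: *"For the operator Δ_a⁻¹ = G we have proved Theorem 3.3 in [5], and especially the bounds
(3.42)"*), `Δ⁽²⁾` is LOCAL of range `r` with column sums `≤ λ` ((3.137)), `G′` solves the resolvent identity
`G′ = G₀ + G₀Δ⁽²⁾G′` (which `(Δ_a − Δ⁽²⁾)G′ = 1`, `G₀Δ_a = 1` give) and is A PRIORI bounded (majorant the constant `M₀` —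
automatic on finite carriers, §5), and `q := κ_N·κ₃·B·λ·e^{δ₁r}·c < 1` (*"Δ⁽²⁾ is a small perturbation of Δ_a"*; the row
sum (2.61) of Lemma 2.1 [3] at the rate `σ ≥ 0` with constant `c`).  Then `G′` has the majorant `B(1 − q)⁻¹e^{−ρd}` for
every `ρ ≥ 0` with `ρ + σ ≤ δ₁` — the template (3.138) of [5] with `Δ′_π` absent (`B11SectG.neumann_majorant`; the
perturbation `K′ = G₀Δ⁽²⁾` costs no rate because `Δ⁽²⁾` is local, `B11Reparam190.hasMaj_comp_localRight`).
[cite: Balaban1985Variational, p.306 after (179), (115) p.294, p.297; Balaban1985BackgroundPropagators, Thm 3.3 (3.42) p.397+p.399, (3.137)–(3.138) p.423; Balaban1984PropagatorsII, Lemma 2.1 (2.61) p.234] -/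
theorem hasMaj_newG_of_fix_local {b3 : BlockNorm g F3} {bN : BlockNorm g FA}
    {G0 G' : F3 →ₗ[ℝ] FA} {D2 : FA →ₗ[ℝ] F3} {KD : g.Site → g.Site → ℝ} {B M₀ δ₁ ρ σ c r lam : ℝ}
    (htri : Triangle254 g) (hd : ∀ a b : g.Site, 0 ≤ g.dist a b) (hrow : RowSum g σ c)
    (hB : 0 ≤ B) (hM₀ : 0 ≤ M₀) (hlam : 0 ≤ lam) (hρ : 0 ≤ ρ) (hσ : 0 ≤ σ) (hρδ : ρ + σ ≤ δ₁)
    (hKD : ∀ a b, 0 ≤ KD a b) (hDloc : ∀ a b, KD a b ≠ 0 → g.dist a b ≤ r)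
    (hDcol : ∀ b, ∑ a : g.Site, KD a b ≤ lam)
    (hG0 : HasMaj b3 bN G0 (fun a b => B * Real.exp (-(δ₁ * g.dist a b)))) (hD2 : HasMaj bN b3 D2 KD)
    (hfix : G' = G0 + (G0 ∘ₗ D2) ∘ₗ G') (hap : HasMaj b3 bN G' (fun _ _ => M₀))
    (hq : bN.κ * (b3.κ * B * lam * Real.exp (δ₁ * r)) * c < 1) :
    HasMaj b3 bN G'
      (fun a b => B * (1 - bN.κ * (b3.κ * B * lam * Real.exp (δ₁ * r)) * c)⁻¹ * Real.exp (-(ρ * g.dist a b))) := by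
  have hδ₁ : 0 ≤ δ₁ := by linarith
  -- K′ = G₀Δ⁽²⁾ : bN → bN has majorant θe^{−δ₁d}, θ = κ₃Bλe^{δ₁r} (the local factor costs no rate)
  have hK : HasMaj bN bN (G0 ∘ₗ D2)
      (fun a b => b3.κ * B * lam * Real.exp (δ₁ * r) * Real.exp (-(δ₁ * g.dist a b))) :=
    hasMaj_comp_localRight htri hB hδ₁ hKD hDloc hDcol hG0 hD2
  have hθ : 0 ≤ b3.κ * B * lam * Real.exp (δ₁ * r) :=
    mul_nonneg (mul_nonneg (mul_nonneg b3.κ_nonneg hB) hlam) (Real.exp_nonneg _)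
  exact neumann_majorant htri hd hrow hθ hB hM₀ hρ hρδ hK (hG0.of_rate_le hd hB (by linarith)) hfix hap hq

/-- **THE SAME WITH AN EXPONENTIAL LETTER OF `Δ⁽²⁾`, TWO ROW SUMS** (the template (3.138) of [5] literally, for a
perturbation of majorant `θe^{−δ₂d}` between two block-normed spaces — cf. `B9SectDL2Decay.rightEntry_majorant`, which is the
one-space case): `G′` has the majorant `B(1 − q)⁻¹e^{−ρd}`, `q := κ_N·(κ₃Bθc)·c`, for every `ρ ≥ 0` with
`ρ + σ ≤ δ₂`, `ρ + 2σ ≤ δ₁`, provided `q < 1`.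
[cite: Balaban1985Variational, p.306 after (179); Balaban1985BackgroundPropagators, (3.137)–(3.138) p.423; Balaban1984PropagatorsII, (2.54) p.233, Lemma 2.1 (2.61) p.234] -/
theorem hasMaj_newG_of_fix_exp {b3 : BlockNorm g F3} {bN : BlockNorm g FA}
    {G0 G' : F3 →ₗ[ℝ] FA} {D2 : FA →ₗ[ℝ] F3} {B θ M₀ δ₁ δ₂ ρ σ c : ℝ}
    (htri : Triangle254 g) (hd : ∀ a b : g.Site, 0 ≤ g.dist a b) (hrow : RowSum g σ c)
    (hB : 0 ≤ B) (hθ : 0 ≤ θ) (hM₀ : 0 ≤ M₀) (hρ : 0 ≤ ρ) (hσ : 0 ≤ σ) (hρ₂ : ρ + σ ≤ δ₂) (hρ₁ : ρ + 2 * σ ≤ δ₁)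
    (hG0 : HasMaj b3 bN G0 (fun a b => B * Real.exp (-(δ₁ * g.dist a b))))
    (hD2 : HasMaj bN b3 D2 (fun a b => θ * Real.exp (-(δ₂ * g.dist a b))))
    (hfix : G' = G0 + (G0 ∘ₗ D2) ∘ₗ G') (hap : HasMaj b3 bN G' (fun _ _ => M₀))
    (hq : bN.κ * (b3.κ * B * θ * c) * c < 1) :
    HasMaj b3 bN G'
      (fun a b => B * (1 - bN.κ * (b3.κ * B * θ * c) * c)⁻¹ * Real.exp (-(ρ * g.dist a b))) := by
  -- K′ = G₀Δ⁽²⁾ at the rate ρ + σ (first row sum)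
  have hK : HasMaj bN bN (G0 ∘ₗ D2)
      (fun a b => b3.κ * B * θ * c * Real.exp (-((ρ + σ) * g.dist a b))) :=
    hasMaj_comp_exp htri hd hrow hB hθ (by linarith) hρ₂ (by linarith) hG0 hD2
  have hc : 0 ≤ c ∨ IsEmpty g.Site := by
    by_cases hne : Nonempty g.Site
    · exact Or.inl (hrow.nonneg (Classical.arbitrary _))
    · exact Or.inr (not_nonempty_iff.mp hne)
  rcases hc with hc | hemp
  · have hθ' : 0 ≤ b3.κ * B * θ * c := mul_nonneg (mul_nonneg (mul_nonneg b3.κ_nonneg hB) hθ) hc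
    exact neumann_majorant htri hd hrow hθ' hB hM₀ hρ le_rfl hK (hG0.of_rate_le hd hB (by linarith)) hfix hap hq
  · intro y' μ _ y
    exact (IsEmpty.false y).elim

/-- **THE RESOLVENT IDENTITY OF p. 306**: if `G₀` is a left inverse of `Δ_a` and `G′` a right inverse of `Δ_a − Δ⁽²⁾`, then
`G′ = G₀ + G₀Δ⁽²⁾G′` (`G₀(Δ_a − Δ⁽²⁾)G′ = G₀`). [cite: Balaban1985Variational, p.306 after (179), (115) p.294] -/
theorem newG_fix_of_inverse {G0 G' : F3 →ₗ[ℝ] FA} {Da D2 : FA →ₗ[ℝ] F3}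
    (hleft : G0 ∘ₗ Da = LinearMap.id) (hright : (Da - D2) ∘ₗ G' = LinearMap.id) :
    G' = G0 + (G0 ∘ₗ D2) ∘ₗ G' := by
  have h : G0 ∘ₗ ((Da - D2) ∘ₗ G') = G0 := by rw [hright, LinearMap.comp_id]
  rw [LinearMap.sub_comp, LinearMap.comp_sub] at h
  have h1 : G0 ∘ₗ (Da ∘ₗ G') = G' := by rw [← LinearMap.comp_assoc, hleft, LinearMap.id_comp]
  rw [h1] at h
  -- h : G' - G0 ∘ₗ (D2 ∘ₗ G') = G0
  rw [LinearMap.comp_assoc]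
  exact sub_eq_iff_eq_add.mp h

end NewG

/-! ## §3  (131)/(143)/(180): `G̃ = G′P₀′* = G′ − G′Q*(QG′Q*)⁻¹QG′` inherits the first entry of `G′` -/

section TildeG

variable {FA F3 FQ : Type} [AddCommGroup FA] [Module ℝ FA] [AddCommGroup F3] [Module ℝ F3]
  [AddCommGroup FQ] [Module ℝ FQ]

/-- **`G̃ = G′P₀′*` HAS THE MAJORANT OF `G′`, UP TO A CONSTANT AND ONE RATE STEP** — `B11TildeG190.hasMaj_leftEntry_tildeG`
with the left entry `E = 1`: `G′ : F3 → FA` of majorant `B_Ge^{−δ_Gd}` (`b3 → bN`), `Q : FA → FQ` and `Q* : FQ → F3` LOCAL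
of range `r_Q` (majorants `K_Q`, `K_{Q*} ≥ 0`, row sums `≤ ν_Q`, column sums `≤ ν_{Q*}`), `Inv = (QG′Q*)⁻¹ : FQ → FQ` of
majorant `B_Ie^{−δ_Id}` between the two B-sizes `bQ → bQ′` (the shape of [5] (3.132)), and `G̃ = G′ − G′Q*·Inv·QG′`
((131) p. 298 with the display of p. 300 corrected, cell GAPS G-adv7-5; p. 306: built on the NEW `G′`).  Then `G̃` has
the majorant `(B_G + κ_Nκ₃κ_Qκ_{Q′}ν_Qν_{Q*}B_IB_G²e^{2δ_Gr_Q}c²)·e^{−ρd}` from `b3` into `bN` for every `ρ, σ ≥ 0` with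
`ρ + σ ≤ δ_G`, `ρ + 2σ ≤ δ_I`. [cite: Balaban1985Variational, (131) p.298, (143) p.300, (180) p.306; Balaban1985BackgroundPropagators, (3.42) p.397, (3.132) p.422; Balaban1984PropagatorsII, (2.52)–(2.56) pp.232–233, Lemma 2.1 (2.61) p.234] -/
theorem hasMaj_tildeG_of_newG {b3 : BlockNorm g F3} {bN : BlockNorm g FA} {bQ bQ' : BlockNorm g FQ}
    {G' Gt : F3 →ₗ[ℝ] FA} {Q : FA →ₗ[ℝ] FQ} {Qs : FQ →ₗ[ℝ] F3} {Inv : FQ →ₗ[ℝ] FQ}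
    {KQ KQs : g.Site → g.Site → ℝ} {BG BI δG δI ρ σ c rQ νQ νs : ℝ}
    (htri : Triangle254 g) (hd : ∀ a b : g.Site, 0 ≤ g.dist a b) (hrow : RowSum g σ c) (hc : 0 ≤ c)
    (hBG : 0 ≤ BG) (hBI : 0 ≤ BI) (hνQ : 0 ≤ νQ) (hνs : 0 ≤ νs) (hρ : 0 ≤ ρ) (hσ : 0 ≤ σ)
    (hρG : ρ + σ ≤ δG) (hρI : ρ + 2 * σ ≤ δI)
    (hGt : Gt = G' - (G' ∘ₗ Qs) ∘ₗ Inv ∘ₗ (Q ∘ₗ G'))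
    (hG' : HasMaj b3 bN G' (fun a b => BG * Real.exp (-(δG * g.dist a b))))
    (hKQ : ∀ a b, 0 ≤ KQ a b) (hQloc : ∀ a b, KQ a b ≠ 0 → g.dist a b ≤ rQ)
    (hQrow : ∀ a, ∑ b : g.Site, KQ a b ≤ νQ) (hQ : HasMaj bN bQ Q KQ)
    (hKQs : ∀ a b, 0 ≤ KQs a b) (hQsloc : ∀ a b, KQs a b ≠ 0 → g.dist a b ≤ rQ)
    (hQscol : ∀ b, ∑ a : g.Site, KQs a b ≤ νs) (hQs : HasMaj bQ' b3 Qs KQs)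
    (hInv : HasMaj bQ bQ' Inv (fun a b => BI * Real.exp (-(δI * g.dist a b)))) :
    HasMaj b3 bN Gt (fun a b =>
      (BG + bN.κ * b3.κ * bQ.κ * bQ'.κ * νQ * νs * BI * BG * BG * Real.exp (δG * rQ) * Real.exp (δG * rQ) * c * c) *
        Real.exp (-(ρ * g.dist a b))) :=
  (hasMaj_leftEntry_tildeG LinearMap.id htri hd hrow hc hBG hBG hBI hνQ hνs hρ hσ hρG hρI hGt hG'
    (hG'.congr fun _ => rfl) hKQ hQloc hQrow hQ hKQs hQsloc hQscol hQs hInv).congr fun _ => rfl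

end TildeG

/-! ## §4  THE ASSEMBLY: the (190) letter of `H₀ + G̃Δ⁽²⁾H₀` — the derivative `(δ/δB)𝓗(0)` of (182) — from the base letters -/

section Assembly

variable {FB FA F3 FQ : Type} [AddCommGroup FB] [Module ℝ FB] [AddCommGroup FA] [Module ℝ FA]
  [AddCommGroup F3] [Module ℝ F3] [AddCommGroup FQ] [Module ℝ FQ]

/-- **THE MAJORANT OF `H₀ + G̃Δ⁽²⁾H₀` FROM THE BASE LETTERS OF SECTS. E–G.**  At `B = 0` the derivative (182) of the chart
(179) is `(δ/δB)𝓗(0) = H₀ + G̃Δ⁽²⁾H₀` in EVERY background (`Beta.RemainderChartOriginDerivative.fderiv_chartH179_zero`: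
by (80) `V` is of order ≥ 3, so the operator inverted in (188) vanishes at the origin).  Its block majorant from the B-size
`bB` into the field size `bN` is assembled here from: **(H₀)** `hH0`, majorant `A₀e^{−δ₀d}` — (129) with *"the bound (3.133)
[5]"*; **(Δ⁽²⁾)** a LOCAL majorant `K_D ≥ 0` of range `r_D` with row and column sums `≤ λ` — (3.137) [5]; **(G₀)** `hG0`,
majorant `Be^{−δ₁d}` of `G₀ = Δ_a⁻¹` — p. 297: *"For the operator Δ_a⁻¹ = G we have proved Theorem 3.3 in [5], and especially
the bounds (3.42)"*; **(G′)** the resolvent identity `G′ = G₀ + G₀Δ⁽²⁾G′` of the new `G′ = (Δ_a − Δ⁽²⁾)⁻¹` (p. 306), an a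
priori bound `M₀` (automatic on finite carriers, §5) and the smallness `q = κ_Nκ₃Bλe^{δ₁r_D}c < 1` (*"Δ⁽²⁾ is a small
perturbation of Δ_a"*); **(P₀′)** `G̃ = G′ − G′Q*·Inv·QG′` ((131), (143)) with `Q`, `Q*` LOCAL of range `r_Q` (row ∕ column
sums `ν_Q`, `ν_{Q*}`) and `Inv = (QG′Q*)⁻¹` of majorant `B_Ie^{−δ_Id}` — the shape of (3.132) [5]; the triangle inequality
(2.54) and the row sum (2.61) of Lemma 2.1 [3] at a rate `σ ≥ 0` with constant `c ≥ 0`.  CONCLUSION: for every `ρ ≥ 0` with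
`ρ ≤ δ₀`, `ρ + 3σ ≤ δ₁`, `ρ + 3σ ≤ δ_I`, the operator `H₀ + G̃Δ⁽²⁾H₀ : FB → FA` has the majorant
`(A₀ + κ₃·B_G̃·θ_D·c)·e^{−ρd}` with `θ_D = κ_NA₀λe^{δ₀r_D}` (§1), `B_{G′} = B(1 − q)⁻¹` at the rate `ρ + 2σ` (§2),
`B_G̃ = B_{G′} + κ_Nκ₃κ_Qκ_{Q′}ν_Qν_{Q*}B_IB_{G′}²e^{2(ρ+2σ)r_Q}c²` at the rate `ρ + σ` (§3) — the four constants bound to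
their closed forms by the hypotheses `hq_def`, `hBG'`, `hBGt`, `hθD` (instantiate with `rfl`).  NO (189), NO (187)–(188),
NO letter of `H` or `𝔇`. [cite: Balaban1985Variational, (129)–(131) pp.297–298, (143) p.300, (180) p.306, (182) p.307, (190) p.308; Balaban1985BackgroundPropagators, Thm 3.3 (3.42) p.397+p.399, (3.132)–(3.133) p.422, (3.137)–(3.138) p.423; Balaban1984PropagatorsII, (2.54) p.233, Lemma 2.1 (2.61) p.234] -/
theorem hasMaj_origin_of_base_letters
    {bB : BlockNorm g FB} {bN : BlockNorm g FA} {b3 : BlockNorm g F3} {bQ bQ' : BlockNorm g FQ}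
    {H0 : FB →ₗ[ℝ] FA} {D2 : FA →ₗ[ℝ] F3} {G0 G' Gt : F3 →ₗ[ℝ] FA}
    {Q : FA →ₗ[ℝ] FQ} {Qs : FQ →ₗ[ℝ] F3} {Inv : FQ →ₗ[ℝ] FQ} {KD KQ KQs : g.Site → g.Site → ℝ}
    {A₀ δ₀ B δ₁ M₀ BI δI lam rD νQ νs rQ ρ σ c q BG' BGt θD : ℝ}
    (htri : Triangle254 g) (hd : ∀ a b : g.Site, 0 ≤ g.dist a b) (hrow : RowSum g σ c) (hc : 0 ≤ c)
    (hσ : 0 ≤ σ) (hρ : 0 ≤ ρ) (hρ₀ : ρ ≤ δ₀) (hρ₁ : ρ + 3 * σ ≤ δ₁) (hρI : ρ + 3 * σ ≤ δI)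
    (hA₀ : 0 ≤ A₀) (hδ₀ : 0 ≤ δ₀) (hB : 0 ≤ B) (hM₀ : 0 ≤ M₀) (hBI : 0 ≤ BI) (hlam : 0 ≤ lam)
    (hνQ : 0 ≤ νQ) (hνs : 0 ≤ νs)
    (hH0 : HasMaj bB bN H0 (fun a b => A₀ * Real.exp (-(δ₀ * g.dist a b))))
    (hKD : ∀ a b, 0 ≤ KD a b) (hDloc : ∀ a b, KD a b ≠ 0 → g.dist a b ≤ rD)
    (hDrow : ∀ a, ∑ b : g.Site, KD a b ≤ lam) (hDcol : ∀ b, ∑ a : g.Site, KD a b ≤ lam)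
    (hD2 : HasMaj bN b3 D2 KD)
    (hG0 : HasMaj b3 bN G0 (fun a b => B * Real.exp (-(δ₁ * g.dist a b))))
    (hfix : G' = G0 + (G0 ∘ₗ D2) ∘ₗ G') (hap : HasMaj b3 bN G' (fun _ _ => M₀))
    (hq_def : q = bN.κ * (b3.κ * B * lam * Real.exp (δ₁ * rD)) * c) (hq : q < 1) (hBG' : BG' = B * (1 - q)⁻¹)
    (hGt : Gt = G' - (G' ∘ₗ Qs) ∘ₗ Inv ∘ₗ (Q ∘ₗ G'))
    (hKQ : ∀ a b, 0 ≤ KQ a b) (hQloc : ∀ a b, KQ a b ≠ 0 → g.dist a b ≤ rQ)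
    (hQrow : ∀ a, ∑ b : g.Site, KQ a b ≤ νQ) (hQ : HasMaj bN bQ Q KQ)
    (hKQs : ∀ a b, 0 ≤ KQs a b) (hQsloc : ∀ a b, KQs a b ≠ 0 → g.dist a b ≤ rQ)
    (hQscol : ∀ b, ∑ a : g.Site, KQs a b ≤ νs) (hQs : HasMaj bQ' b3 Qs KQs)
    (hInv : HasMaj bQ bQ' Inv (fun a b => BI * Real.exp (-(δI * g.dist a b))))
    (hBGt : BGt = BG' + bN.κ * b3.κ * bQ.κ * bQ'.κ * νQ * νs * BI * BG' * BG' *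
      Real.exp ((ρ + 2 * σ) * rQ) * Real.exp ((ρ + 2 * σ) * rQ) * c * c)
    (hθD : θD = bN.κ * A₀ * lam * Real.exp (δ₀ * rD)) :
    HasMaj bB bN (H0 + Gt ∘ₗ (D2 ∘ₗ H0))
      (fun a b => (A₀ + b3.κ * BGt * θD * c) * Real.exp (-(ρ * g.dist a b))) := by
  -- §1: Δ⁽²⁾H₀ at the rate δ₀
  have h1 : HasMaj bB b3 (D2 ∘ₗ H0) (fun a b => θD * Real.exp (-(δ₀ * g.dist a b))) := by
    rw [hθD]; exact hasMaj_D2H0_of_local htri hA₀ hδ₀ hKD hDloc hDrow hD2 hH0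
  have hθD0 : 0 ≤ θD := by
    rw [hθD]; exact mul_nonneg (mul_nonneg (mul_nonneg bN.κ_nonneg hA₀) hlam) (Real.exp_nonneg _)
  -- §2: the new G′ at the rate ρ + 2σ
  have hq0 : 0 ≤ q := by
    rw [hq_def]
    exact mul_nonneg (mul_nonneg bN.κ_nonneg
      (mul_nonneg (mul_nonneg (mul_nonneg b3.κ_nonneg hB) hlam) (Real.exp_nonneg _))) hc
  have hBG'0 : 0 ≤ BG' := by rw [hBG']; exact mul_nonneg hB (inv_nonneg.mpr (by linarith))
  have h2 : HasMaj b3 bN G' (fun a b => BG' * Real.exp (-((ρ + 2 * σ) * g.dist a b))) := by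
    rw [hBG', hq_def]
    exact hasMaj_newG_of_fix_local htri hd hrow hB hM₀ hlam (by linarith) hσ (by linarith) hKD hDloc hDcol hG0 hD2
      hfix hap (by rw [← hq_def]; exact hq)
  -- §3: G̃ at the rate ρ + σ
  have h3 : HasMaj b3 bN Gt (fun a b => BGt * Real.exp (-((ρ + σ) * g.dist a b))) := by
    rw [hBGt]
    exact hasMaj_tildeG_of_newG htri hd hrow hc hBG'0 hBI hνQ hνs (by linarith) hσ (by linarith) (by linarith)
      hGt h2 hKQ hQloc hQrow hQ hKQs hQsloc hQscol hQs hInv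
  have hBGt0 : 0 ≤ BGt := by
    rw [hBGt]
    have := bN.κ_nonneg; have := b3.κ_nonneg; have := bQ.κ_nonneg; have := bQ'.κ_nonneg
    positivity
  -- G̃ ∘ (Δ⁽²⁾H₀) at the rate ρ (one more row sum), plus H₀ at the rate ρ
  have h4 : HasMaj bB bN (Gt ∘ₗ (D2 ∘ₗ H0))
      (fun a b => b3.κ * BGt * θD * c * Real.exp (-(ρ * g.dist a b))) :=
    hasMaj_comp_exp htri hd hrow hBGt0 hθD0 hρ hρ₀ (le_refl (ρ + σ)) h3 h1
  have h5 : HasMaj bB bN H0 (fun a b => A₀ * Real.exp (-(ρ * g.dist a b))) := hH0.of_rate_le hd hA₀ hρ₀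
  exact (h5.add h4).mono fun a b => le_of_eq (by ring)

/-- **THE (190) LETTER OF `(δ/δB)𝓗(0) = H₀ + G̃Δ⁽²⁾H₀` FROM THE BASE LETTERS**: under the hypotheses of
`hasMaj_origin_of_base_letters`, `Ineq190 bB bN (H₀ + G̃Δ⁽²⁾H₀) (A₀ + κ₃B_G̃θ_Dc) δ` for every `δ` with `δ/8 ≤ ρ` — entries
`n = 0, 1` of (190) at the origin, in the currency of `B11SectG.ineq190_of_189` ∕ `B11.Prop9Printed`, WITHOUT (189), (187)–(188)
or any letter of `H`, `𝔇`; the located inputs are EXACTLY the base propagator letters of [5] in the background field ((3.133)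
for `H₀`, Thm 3.3 (3.42) for `Δ_a⁻¹`, (3.132) for `(QG′Q*)⁻¹`), the locality of `Δ⁽²⁾`, `Q`, `Q*`, the existence of
`(Δ_a − Δ⁽²⁾)⁻¹` with an a priori bound, and ONE smallness `q < 1`.
[cite: Balaban1985Variational, (182) p.307, (190) p.308, (180) p.306; Balaban1985BackgroundPropagators, Thm 3.3 (3.42) p.397+p.399, (3.132)–(3.133) p.422, (3.137) p.423; Balaban1984PropagatorsII, Lemma 2.1 (2.61) p.234] -/
theorem ineq190_origin_of_base_letters
    {bB : BlockNorm g FB} {bN : BlockNorm g FA} {b3 : BlockNorm g F3} {bQ bQ' : BlockNorm g FQ}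
    {H0 : FB →ₗ[ℝ] FA} {D2 : FA →ₗ[ℝ] F3} {G0 G' Gt : F3 →ₗ[ℝ] FA}
    {Q : FA →ₗ[ℝ] FQ} {Qs : FQ →ₗ[ℝ] F3} {Inv : FQ →ₗ[ℝ] FQ} {KD KQ KQs : g.Site → g.Site → ℝ}
    {A₀ δ₀ B δ₁ M₀ BI δI lam rD νQ νs rQ ρ σ c q BG' BGt θD δ : ℝ}
    (htri : Triangle254 g) (hd : ∀ a b : g.Site, 0 ≤ g.dist a b) (hrow : RowSum g σ c) (hc : 0 ≤ c)
    (hσ : 0 ≤ σ) (hρ : 0 ≤ ρ) (hρ₀ : ρ ≤ δ₀) (hρ₁ : ρ + 3 * σ ≤ δ₁) (hρI : ρ + 3 * σ ≤ δI) (hδ : δ / 8 ≤ ρ)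
    (hA₀ : 0 ≤ A₀) (hδ₀ : 0 ≤ δ₀) (hB : 0 ≤ B) (hM₀ : 0 ≤ M₀) (hBI : 0 ≤ BI) (hlam : 0 ≤ lam)
    (hνQ : 0 ≤ νQ) (hνs : 0 ≤ νs)
    (hH0 : HasMaj bB bN H0 (fun a b => A₀ * Real.exp (-(δ₀ * g.dist a b))))
    (hKD : ∀ a b, 0 ≤ KD a b) (hDloc : ∀ a b, KD a b ≠ 0 → g.dist a b ≤ rD)
    (hDrow : ∀ a, ∑ b : g.Site, KD a b ≤ lam) (hDcol : ∀ b, ∑ a : g.Site, KD a b ≤ lam)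
    (hD2 : HasMaj bN b3 D2 KD)
    (hG0 : HasMaj b3 bN G0 (fun a b => B * Real.exp (-(δ₁ * g.dist a b))))
    (hfix : G' = G0 + (G0 ∘ₗ D2) ∘ₗ G') (hap : HasMaj b3 bN G' (fun _ _ => M₀))
    (hq_def : q = bN.κ * (b3.κ * B * lam * Real.exp (δ₁ * rD)) * c) (hq : q < 1) (hBG' : BG' = B * (1 - q)⁻¹)
    (hGt : Gt = G' - (G' ∘ₗ Qs) ∘ₗ Inv ∘ₗ (Q ∘ₗ G'))
    (hKQ : ∀ a b, 0 ≤ KQ a b) (hQloc : ∀ a b, KQ a b ≠ 0 → g.dist a b ≤ rQ)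
    (hQrow : ∀ a, ∑ b : g.Site, KQ a b ≤ νQ) (hQ : HasMaj bN bQ Q KQ)
    (hKQs : ∀ a b, 0 ≤ KQs a b) (hQsloc : ∀ a b, KQs a b ≠ 0 → g.dist a b ≤ rQ)
    (hQscol : ∀ b, ∑ a : g.Site, KQs a b ≤ νs) (hQs : HasMaj bQ' b3 Qs KQs)
    (hInv : HasMaj bQ bQ' Inv (fun a b => BI * Real.exp (-(δI * g.dist a b))))
    (hBGt : BGt = BG' + bN.κ * b3.κ * bQ.κ * bQ'.κ * νQ * νs * BI * BG' * BG' *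
      Real.exp ((ρ + 2 * σ) * rQ) * Real.exp ((ρ + 2 * σ) * rQ) * c * c)
    (hθD : θD = bN.κ * A₀ * lam * Real.exp (δ₀ * rD)) :
    Ineq190 bB bN (H0 + Gt ∘ₗ (D2 ∘ₗ H0)) (A₀ + b3.κ * BGt * θD * c) δ := by
  have h := hasMaj_origin_of_base_letters htri hd hrow hc hσ hρ hρ₀ hρ₁ hρI hA₀ hδ₀ hB hM₀ hBI hlam hνQ hνs hH0 hKD
    hDloc hDrow hDcol hD2 hG0 hfix hap hq_def hq hBG' hGt hKQ hQloc hQrow hQ hKQs hQsloc hQscol hQs hInv hBGt hθD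
  -- the constant is non-negative (read off the majorant of a localized input if 𝔅 is non-empty; vacuous otherwise)
  intro y' μ hμ y
  have hC : 0 ≤ A₀ + b3.κ * BGt * θD * c := by
    have hθD0 : 0 ≤ θD := by
      rw [hθD]; exact mul_nonneg (mul_nonneg (mul_nonneg bN.κ_nonneg hA₀) hlam) (Real.exp_nonneg _)
    have hq0 : 0 ≤ q := by
      rw [hq_def]
      exact mul_nonneg (mul_nonneg bN.κ_nonneg
        (mul_nonneg (mul_nonneg (mul_nonneg b3.κ_nonneg hB) hlam) (Real.exp_nonneg _))) hc
    have hBG'0 : 0 ≤ BG' := by rw [hBG']; exact mul_nonneg hB (inv_nonneg.mpr (by linarith))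
    have hBGt0 : 0 ≤ BGt := by
      rw [hBGt]
      have := bN.κ_nonneg; have := b3.κ_nonneg; have := bQ.κ_nonneg; have := bQ'.κ_nonneg
      positivity
    have := b3.κ_nonneg
    positivity
  refine (h y' μ hμ y).trans (mul_le_mul_of_nonneg_right ?_ (bB.loc_nonneg _ _))
  exact mul_le_mul_of_nonneg_left (Real.exp_le_exp.mpr (by nlinarith [hd y y'])) hC

end Assembly

/-! ## §5  Finite carriers with the sup sizes of (190): the a priori bound is automatic and `(Δ_a − Δ⁽²⁾)⁻¹` EXISTS under `q < 1` -/

section SupSize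

variable {X : Type} [Fintype X] {E : Type} [NormedAddCommGroup E] [NormedSpace ℂ E]
  {box : g.Site → Finset X} {blk : X → g.Site}

/-- **EVERY BOUNDED OPERATOR HAS THE CONSTANT MAJORANT `‖T‖` between the sup sizes of (190)** (boxes = the fibres of the
block map): a function localized in the block of `v` has sup norm `≤` its size at `v`, and every local size of `Tμ` is
`≤ ‖Tμ‖ ≤ ‖T‖·‖μ‖` — so on finite carriers the A PRIORI BOUND of `B11SectG.neumann_majorant` ∕ §2 costs nothing.
[cite: Balaban1985Variational, (188) p.308, (190) p.308; Balaban1984PropagatorsII, (2.51)–(2.52) p.232] -/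
theorem hasMaj_supSize_const_of_opNorm (hbox : ∀ y x, x ∈ box y ↔ blk x = y) (T : (X → E) →L[ℂ] (X → E)) :
    HasMaj (supSize g box blk) (supSize g box blk) (T.restrictScalars ℝ : (X → E) →ₗ[ℝ] (X → E))
      (fun _ _ => ‖T‖) := by
  intro v μ hμ y
  have hμv : ∀ x, blk x ≠ v → μ x = 0 := (supSize_isLoc_iff v μ).1 hμ
  have hF0 : 0 ≤ (supSize g box blk : BlockNorm g (X → E)).loc v μ :=
    (supSize g box blk : BlockNorm g (X → E)).loc_nonneg v μ
  have hμF : ‖μ‖ ≤ (supSize g box blk : BlockNorm g (X → E)).loc v μ := by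
    refine (pi_norm_le_iff_of_nonneg hF0).mpr fun x => ?_
    by_cases hx : blk x = v
    · exact norm_apply_le_loc ((hbox v x).2 hx) μ
    · rw [hμv x hx, norm_zero]; exact hF0
  refine loc_le_of_forall (mul_nonneg (norm_nonneg _) hF0) fun x _ => ?_
  calc ‖(T.restrictScalars ℝ : (X → E) →ₗ[ℝ] (X → E)) μ x‖ = ‖T μ x‖ := rfl
    _ ≤ ‖T μ‖ := norm_le_pi_norm _ x
    _ ≤ ‖T‖ * ‖μ‖ := T.le_opNorm μ
    _ ≤ ‖T‖ * (supSize g box blk : BlockNorm g (X → E)).loc v μ := mul_le_mul_of_nonneg_left hμF (norm_nonneg _)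

/-- **THE OPERATOR NORM FROM A DECAYING MAJORANT** between the sup sizes of (190): a majorant `Ce^{−ρd}` (`C ≥ 0`) and the
row sum (2.61) at the rate `ρ` with constant `c ≥ 0` give `‖T‖ ≤ C·c` in the sup norm — every point lies in the box of its
block, and `B11TildeG190.opBound_of_hasMaj_exp` bounds every local size of `Tf` by `Cc·sup_{y′}loc_{y′}f ≤ Cc‖f‖`.
[cite: Balaban1985Variational, (130) p.298, (187) p.308; Balaban1984PropagatorsII, (2.52)–(2.53) p.232, Lemma 2.1 (2.61) p.234] -/
theorem opNorm_le_of_hasMaj_supSize (hbox : ∀ y x, x ∈ box y ↔ blk x = y) (T : (X → E) →L[ℂ] (X → E))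
    {C ρ c : ℝ} (hC : 0 ≤ C) (hc : 0 ≤ c) (hrow : RowSum g ρ c)
    (h : HasMaj (supSize g box blk) (supSize g box blk) (T.restrictScalars ℝ : (X → E) →ₗ[ℝ] (X → E))
      (fun a b => C * Real.exp (-(ρ * g.dist a b)))) :
    ‖T‖ ≤ C * c := by
  refine T.opNorm_le_bound (mul_nonneg hC hc) fun f => ?_
  refine (pi_norm_le_iff_of_nonneg (mul_nonneg (mul_nonneg hC hc) (norm_nonneg f))).mpr fun x => ?_
  have hM : ∀ y', (supSize g box blk : BlockNorm g (X → E)).loc y' f ≤ ‖f‖ := fun y' =>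
    loc_le_of_forall (norm_nonneg f) fun x' _ => norm_le_pi_norm f x'
  have hb := opBound_of_hasMaj_exp (supSize g box blk) (supSize g box blk) hC hrow h f (norm_nonneg f) hM (blk x)
  calc ‖T f x‖ = ‖(T.restrictScalars ℝ : (X → E) →ₗ[ℝ] (X → E)) f x‖ := rfl
    _ ≤ (supSize g box blk : BlockNorm g (X → E)).loc (blk x) ((T.restrictScalars ℝ : (X → E) →ₗ[ℝ] (X → E)) f) :=
        norm_apply_le_loc ((hbox (blk x) x).2 rfl) _
    _ ≤ (supSize g box blk : BlockNorm g (X → E)).κ * C * c * ‖f‖ := hb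
    _ = C * c * ‖f‖ := by rw [supSize_κ, one_mul]

variable [CompleteSpace E]

/-- **p. 306, KERNEL-CHECKED ON FINITE CARRIERS: `G′ = (Δ_a − Δ⁽²⁾)⁻¹` EXISTS AND *"has exactly the same properties as
Δ_a⁻¹"* (first entry).**  On `X → E` (finite `X`, sup norm; the sup sizes of (190) with boxes = fibres of the block map) let
`Δ_a` be invertible with inverse `G₀` (`G₀Δ_a = 1 = Δ_aG₀`), `G₀` of majorant `Be^{−δ₁d}` ((3.42), first entry), `Δ⁽²⁾` LOCAL
of range `r` with column sums `≤ λ` ((3.137)), the row sum (2.61) at a rate `0 ≤ σ ≤ δ₁` with constant `c ≥ 0`, and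
`q := Bλe^{δ₁r}c < 1`.  Then `‖G₀Δ⁽²⁾‖ ≤ q < 1` (sup operator norm), `1 − G₀Δ⁽²⁾` is a unit of the Banach algebra of
operators (Mathlib `isUnit_one_sub_of_norm_lt_one`), `G′ := (1 − G₀Δ⁽²⁾)⁻¹G₀` is a two-sided inverse of `Δ_a − Δ⁽²⁾`
solving `G′ = G₀ + G₀Δ⁽²⁾G′`, and for every `ρ ≥ 0` with `ρ + σ ≤ δ₁` it has the majorant `B(1 − q)⁻¹e^{−ρd}` (§2 with the
a priori bound of `hasMaj_supSize_const_of_opNorm`).  Cell GAPS G-B11-G1, first entry, in the sup currency of row (D4).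
[cite: Balaban1985Variational, p.306 after (179), (115) p.294, p.297; Balaban1985BackgroundPropagators, Thm 3.3 (3.42) p.397+p.399, (3.137)–(3.138) p.423; Balaban1984PropagatorsII, (2.52)–(2.53) p.232, Lemma 2.1 (2.61) p.234] -/
theorem exists_newG_supSize (hbox : ∀ y x, x ∈ box y ↔ blk x = y) (Da G0 D2 : (X → E) →L[ℂ] (X → E))
    (hleft : G0 * Da = 1) (hright : Da * G0 = 1) {KD : g.Site → g.Site → ℝ} {B δ₁ σ c r lam : ℝ}
    (htri : Triangle254 g) (hd : ∀ a b : g.Site, 0 ≤ g.dist a b) (hrow : RowSum g σ c) (hc : 0 ≤ c)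
    (hB : 0 ≤ B) (hlam : 0 ≤ lam) (hσ : 0 ≤ σ) (hσδ : σ ≤ δ₁)
    (hKD : ∀ a b, 0 ≤ KD a b) (hDloc : ∀ a b, KD a b ≠ 0 → g.dist a b ≤ r) (hDcol : ∀ b, ∑ a : g.Site, KD a b ≤ lam)
    (hG0 : HasMaj (supSize g box blk) (supSize g box blk) (G0.restrictScalars ℝ : (X → E) →ₗ[ℝ] (X → E))
      (fun a b => B * Real.exp (-(δ₁ * g.dist a b))))
    (hD2 : HasMaj (supSize g box blk) (supSize g box blk) (D2.restrictScalars ℝ : (X → E) →ₗ[ℝ] (X → E)) KD)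
    (hq : B * lam * Real.exp (δ₁ * r) * c < 1) :
    ∃ G' : (X → E) →L[ℂ] (X → E), G' * (Da - D2) = 1 ∧ (Da - D2) * G' = 1 ∧ G' = G0 + G0 * D2 * G' ∧
      ‖G0 * D2‖ ≤ B * lam * Real.exp (δ₁ * r) * c ∧
      ∀ ρ : ℝ, 0 ≤ ρ → ρ + σ ≤ δ₁ →
        HasMaj (supSize g box blk) (supSize g box blk) (G'.restrictScalars ℝ : (X → E) →ₗ[ℝ] (X → E))
          (fun a b => B * (1 - B * lam * Real.exp (δ₁ * r) * c)⁻¹ * Real.exp (-(ρ * g.dist a b))) := by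
  have hδ₁ : 0 ≤ δ₁ := hσ.trans hσδ
  set K : (X → E) →L[ℂ] (X → E) := G0 * D2 with hK_def
  -- the majorant of K = G₀Δ⁽²⁾ (local factor on the right: no rate lost) and its operator norm
  have hKmaj : HasMaj (supSize g box blk) (supSize g box blk) (K.restrictScalars ℝ : (X → E) →ₗ[ℝ] (X → E))
      (fun a b => (supSize g box blk : BlockNorm g (X → E)).κ * B * lam * Real.exp (δ₁ * r) *
        Real.exp (-(δ₁ * g.dist a b))) :=
    (hasMaj_comp_localRight htri hB hδ₁ hKD hDloc hDcol hG0 hD2).congr fun _ => rfl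
  have hKnorm : ‖K‖ ≤ B * lam * Real.exp (δ₁ * r) * c := by
    have h := opNorm_le_of_hasMaj_supSize hbox K
      (mul_nonneg (mul_nonneg (mul_nonneg (supSize g box blk : BlockNorm g (X → E)).κ_nonneg hB) hlam)
        (Real.exp_nonneg _)) hc (hrow.mono hd hσδ) hKmaj
    rwa [supSize_κ, one_mul] at h
  have hK1 : ‖K‖ < 1 := hKnorm.trans_lt hq
  obtain ⟨u, hu⟩ := isUnit_one_sub_of_norm_lt_one hK1
  refine ⟨(↑u⁻¹ : (X → E) →L[ℂ] (X → E)) * G0, ?_, ?_, ?_, hKnorm, ?_⟩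
  · -- left inverse: u⁻¹G₀(Δ_a − Δ⁽²⁾) = u⁻¹(1 − K) = 1
    rw [mul_assoc, mul_sub, hleft, ← hK_def, ← hu, Units.inv_mul]
  · -- right inverse: (Δ_a − Δ⁽²⁾)u⁻¹G₀ = Δ_a(1 − K)u⁻¹G₀ = Δ_aG₀ = 1
    have e1 : Da - D2 = Da * (1 - K) := by
      rw [mul_sub, mul_one, hK_def, ← mul_assoc, hright, one_mul]
    rw [e1, ← hu, mul_assoc, ← mul_assoc (↑u : (X → E) →L[ℂ] (X → E)), Units.mul_inv, one_mul, hright]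
  · -- the resolvent identity: (1 − K)G′ = G₀
    have e2 : (1 - K) * ((↑u⁻¹ : (X → E) →L[ℂ] (X → E)) * G0) = G0 := by
      rw [← hu, ← mul_assoc, Units.mul_inv, one_mul]
    rw [sub_mul, one_mul, sub_eq_iff_eq_add] at e2
    exact e2
  · intro ρ hρ hρδ
    set G' : (X → E) →L[ℂ] (X → E) := (↑u⁻¹ : (X → E) →L[ℂ] (X → E)) * G0 with hG'_def
    have e2 : (1 - K) * G' = G0 := by
      rw [hG'_def, ← hu, ← mul_assoc, Units.mul_inv, one_mul]
    have hfixC : G' = G0 + K * G' := by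
      rw [sub_mul, one_mul, sub_eq_iff_eq_add] at e2
      exact e2
    have hfix : (G'.restrictScalars ℝ : (X → E) →ₗ[ℝ] (X → E)) =
        (G0.restrictScalars ℝ : (X → E) →ₗ[ℝ] (X → E)) +
          ((G0.restrictScalars ℝ : (X → E) →ₗ[ℝ] (X → E)) ∘ₗ (D2.restrictScalars ℝ : (X → E) →ₗ[ℝ] (X → E))) ∘ₗ
            (G'.restrictScalars ℝ : (X → E) →ₗ[ℝ] (X → E)) := by
      apply LinearMap.ext
      intro f
      have e := congrArg (fun T : (X → E) →L[ℂ] (X → E) => T f) hfixC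
      simpa [hK_def] using e
    have hap := hasMaj_supSize_const_of_opNorm (g := g) hbox G'
    have h := hasMaj_newG_of_fix_local htri hd hrow hB (norm_nonneg G') hlam hρ hσ hρδ hKD hDloc hDcol hG0 hD2
      hfix hap (by simpa only [supSize_κ, one_mul] using hq)
    refine h.mono fun a b => le_of_eq ?_
    simp only [supSize_κ, one_mul]

end SupSize

/-! ## §6  END on finite carriers: the (190) letter of `H₀ + G̃Δ⁽²⁾H₀` from `hH0`, `hG0`, the three local letters, `hInv` and the invertibility of `Δ_a − Δ⁽²⁾` -/

section SupSizeEnd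

variable {X : Type} [Fintype X] {E : Type} [NormedAddCommGroup E] [NormedSpace ℂ E]
  {box : g.Site → Finset X} {blk : X → g.Site}
  {FB FQ : Type} [AddCommGroup FB] [Module ℝ FB] [AddCommGroup FQ] [Module ℝ FQ]

/-- **NODE D OF ROW (D4) AT THE ORIGIN, IN A BACKGROUND, ON FINITE CARRIERS — THE LETTER LIST.**  Fields `X → E` (finite `X`,
sup sizes of (190) `S` with boxes = fibres of the block map, `κ = 1`), B-data in any block-normed space `bB`, the `Q`-images in
any `FQ` with two sizes `bQ`, `bQ′`.  GIVEN: `Δ_a` with the left inverse `G₀` (`G₀Δ_a = 1`) of majorant `Be^{−δ₁d}` ([5] Thm 3.3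
(3.42), first entry — `hG0`); `G′` a right inverse of `Δ_a − Δ⁽²⁾` (`(Δ_a − Δ⁽²⁾)G′ = 1`; it EXISTS under `q < 1`,
`exists_newG_supSize`); `H₀` of majorant `A₀e^{−δ₀d}` ((3.133) — `hH0`); `Δ⁽²⁾`, `Q`, `Q*` LOCAL ((3.137); ranges `r_D`, `r_Q`,
row∕column sums `λ`, `ν_Q`, `ν_{Q*}`); `Inv = (QG′Q*)⁻¹` of majorant `B_Ie^{−δ_Id}` ((3.132)-shape — `hInv`); `G̃ = G′ − G′Q*·Inv·QG′`
((131)/(143)); (2.54), (2.61) at the rate `σ` with constant `c`; `q = Bλe^{δ₁r_D}c < 1`.  THEN for `0 ≤ ρ ≤ δ₀`, `ρ + 3σ ≤ δ₁`,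
`ρ + 3σ ≤ δ_I`, `δ/8 ≤ ρ`: `Ineq190 bB S (H₀ + G̃Δ⁽²⁾H₀) (A₀ + B_G̃·θ_D·c) δ` with `θ_D = A₀λe^{δ₀r_D}`, `B_{G′} = B(1 − q)⁻¹`,
`B_G̃ = B_{G′} + κ_Qκ_{Q′}ν_Qν_{Q*}B_IB_{G′}²e^{2(ρ+2σ)r_Q}c²` — the a priori bound and the resolvent identity of §4 DISCHARGED
(`hasMaj_supSize_const_of_opNorm`, `newG_fix_of_inverse`).  With `Beta.RemainderChartOriginDerivative.restrictScalars_fderiv_chartH179_zero`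
the operator IS `(δ/δB)𝓗(0)` of the (179)-chart in the regime of (180).
[cite: Balaban1985Variational, (129)–(131) pp.297–298, (143) p.300, (180) p.306, (182) p.307, (190) p.308; Balaban1985BackgroundPropagators, Thm 3.3 (3.42) p.397+p.399, (3.132)–(3.133) p.422, (3.137)–(3.138) p.423; Balaban1984PropagatorsII, (2.54) p.233, Lemma 2.1 (2.61) p.234] -/
theorem ineq190_origin_supSize (hbox : ∀ y x, x ∈ box y ↔ blk x = y)
    {bB : BlockNorm g FB} {bQ bQ' : BlockNorm g FQ}
    (Da G0 D2 G' : (X → E) →L[ℂ] (X → E)) (hleft : G0 * Da = 1) (hright' : (Da - D2) * G' = 1)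
    {H0 : FB →ₗ[ℝ] (X → E)} {Q : (X → E) →ₗ[ℝ] FQ} {Qs : FQ →ₗ[ℝ] (X → E)} {Inv : FQ →ₗ[ℝ] FQ}
    {Gt : (X → E) →ₗ[ℝ] (X → E)} {KD KQ KQs : g.Site → g.Site → ℝ}
    {A₀ δ₀ B δ₁ BI δI lam rD νQ νs rQ ρ σ c q BG' BGt θD δ : ℝ}
    (htri : Triangle254 g) (hd : ∀ a b : g.Site, 0 ≤ g.dist a b) (hrow : RowSum g σ c) (hc : 0 ≤ c)
    (hσ : 0 ≤ σ) (hρ : 0 ≤ ρ) (hρ₀ : ρ ≤ δ₀) (hρ₁ : ρ + 3 * σ ≤ δ₁) (hρI : ρ + 3 * σ ≤ δI) (hδ : δ / 8 ≤ ρ)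
    (hA₀ : 0 ≤ A₀) (hδ₀ : 0 ≤ δ₀) (hB : 0 ≤ B) (hBI : 0 ≤ BI) (hlam : 0 ≤ lam) (hνQ : 0 ≤ νQ) (hνs : 0 ≤ νs)
    (hH0 : HasMaj bB (supSize g box blk) H0 (fun a b => A₀ * Real.exp (-(δ₀ * g.dist a b))))
    (hKD : ∀ a b, 0 ≤ KD a b) (hDloc : ∀ a b, KD a b ≠ 0 → g.dist a b ≤ rD)
    (hDrow : ∀ a, ∑ b : g.Site, KD a b ≤ lam) (hDcol : ∀ b, ∑ a : g.Site, KD a b ≤ lam)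
    (hD2 : HasMaj (supSize g box blk) (supSize g box blk) (D2.restrictScalars ℝ : (X → E) →ₗ[ℝ] (X → E)) KD)
    (hG0 : HasMaj (supSize g box blk) (supSize g box blk) (G0.restrictScalars ℝ : (X → E) →ₗ[ℝ] (X → E))
      (fun a b => B * Real.exp (-(δ₁ * g.dist a b))))
    (hq_def : q = B * lam * Real.exp (δ₁ * rD) * c) (hq : q < 1) (hBG' : BG' = B * (1 - q)⁻¹)
    (hGt : Gt = (G'.restrictScalars ℝ : (X → E) →ₗ[ℝ] (X → E)) -
      ((G'.restrictScalars ℝ : (X → E) →ₗ[ℝ] (X → E)) ∘ₗ Qs) ∘ₗ Inv ∘ₗ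
        (Q ∘ₗ (G'.restrictScalars ℝ : (X → E) →ₗ[ℝ] (X → E))))
    (hKQ : ∀ a b, 0 ≤ KQ a b) (hQloc : ∀ a b, KQ a b ≠ 0 → g.dist a b ≤ rQ)
    (hQrow : ∀ a, ∑ b : g.Site, KQ a b ≤ νQ) (hQ : HasMaj (supSize g box blk) bQ Q KQ)
    (hKQs : ∀ a b, 0 ≤ KQs a b) (hQsloc : ∀ a b, KQs a b ≠ 0 → g.dist a b ≤ rQ)
    (hQscol : ∀ b, ∑ a : g.Site, KQs a b ≤ νs) (hQs : HasMaj bQ' (supSize g box blk) Qs KQs)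
    (hInv : HasMaj bQ bQ' Inv (fun a b => BI * Real.exp (-(δI * g.dist a b))))
    (hBGt : BGt = BG' + bQ.κ * bQ'.κ * νQ * νs * BI * BG' * BG' *
      Real.exp ((ρ + 2 * σ) * rQ) * Real.exp ((ρ + 2 * σ) * rQ) * c * c)
    (hθD : θD = A₀ * lam * Real.exp (δ₀ * rD)) :
    Ineq190 bB (supSize g box blk)
      (H0 + Gt ∘ₗ ((D2.restrictScalars ℝ : (X → E) →ₗ[ℝ] (X → E)) ∘ₗ H0)) (A₀ + BGt * θD * c) δ := by
  -- the resolvent identity of the new G′ over ℝ, from the two inverse relations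
  have hleft' : (G0.restrictScalars ℝ : (X → E) →ₗ[ℝ] (X → E)) ∘ₗ (Da.restrictScalars ℝ : (X → E) →ₗ[ℝ] (X → E)) =
      LinearMap.id := by
    apply LinearMap.ext
    intro f
    have e := congrArg (fun T : (X → E) →L[ℂ] (X → E) => T f) hleft
    simpa using e
  have hright'' : ((Da.restrictScalars ℝ : (X → E) →ₗ[ℝ] (X → E)) - (D2.restrictScalars ℝ : (X → E) →ₗ[ℝ] (X → E))) ∘ₗ
      (G'.restrictScalars ℝ : (X → E) →ₗ[ℝ] (X → E)) = LinearMap.id := by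
    apply LinearMap.ext
    intro f
    have e := congrArg (fun T : (X → E) →L[ℂ] (X → E) => T f) hright'
    simpa using e
  have hfix := newG_fix_of_inverse hleft' hright''
  -- the a priori bound is automatic
  have hap := hasMaj_supSize_const_of_opNorm (g := g) hbox G'
  have hq_def' : q = (supSize g box blk : BlockNorm g (X → E)).κ *
      ((supSize g box blk : BlockNorm g (X → E)).κ * B * lam * Real.exp (δ₁ * rD)) * c := by
    rw [hq_def, supSize_κ, one_mul, one_mul]
  have hBGt' : BGt = BG' + (supSize g box blk : BlockNorm g (X → E)).κ * (supSize g box blk : BlockNorm g (X → E)).κ *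
      bQ.κ * bQ'.κ * νQ * νs * BI * BG' * BG' * Real.exp ((ρ + 2 * σ) * rQ) * Real.exp ((ρ + 2 * σ) * rQ) * c * c := by
    rw [hBGt, supSize_κ, one_mul, one_mul]
  have hθD' : θD = (supSize g box blk : BlockNorm g (X → E)).κ * A₀ * lam * Real.exp (δ₀ * rD) := by
    rw [hθD, supSize_κ, one_mul]
  have h := ineq190_origin_of_base_letters htri hd hrow hc hσ hρ hρ₀ hρ₁ hρI hδ hA₀ hδ₀ hB (norm_nonneg G') hBI hlam
    hνQ hνs hH0 hKD hDloc hDrow hDcol hD2 hG0 hfix hap hq_def' hq hBG' hGt hKQ hQloc hQrow hQ hKQs hQsloc hQscol hQs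
    hInv hBGt' hθD'
  rwa [supSize_κ, one_mul] at h

end SupSizeEnd

end Literature.MathematicalPhysics.QuantumFieldTheory.Balaban1983to89.Beta.RemainderOriginBaseLetters
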